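import Literature.AlgebraicGeometry.Resolution.HenselChartInField
import HarnessLib

/-!
# The étale chart of a simple root, realized inside a field

Topic: `Literature/AlgebraicGeometry/Resolution` (valued function fields; étale charts of models).
Groundwork for the algebraization step of M. Temkin, *Inseparable local uniformization*,
J. Algebra 373 (2013) = arXiv:0804.1554v3, Thm. 3.3.1 (tree: `Temkin2013RelativeCurveSmoothFibre`).
`HenselChartInField.exists_henselChart` realizes the standard étale algebra of the ZOOMED
polynomial of a Newton datum `(P, y, β)` as an étale subalgebra of the field; the second
`K`-side chart of the level-wise construction (`DESIGN-J2-v2`: the disc coordinate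
`x′ = (x − a)/c` is a simple Hensel root of `H(S) = P(x − cS)/(−cP′(x))`,
`SplitDiscNewton.henselPoly_discCoordinate`) needs the same for an ARBITRARY polynomial
`p ∈ R[X]` with a root `θ` in the field at which `p′(θ) ≠ 0`: the standard étale `R`-algebra
`(R[X]/p)[1/p′]` (an `EtalePair`, `DecompletionEtalePair.lean`) maps to the field by `X ↦ θ`,
is cut down to the sheet of `θ` (`EtaleChartInField.lean`: `s₀ ↦ 1`, `s₀ · ker = 0`, then
`(R[X]/p)[1/p′][1/s₀] → L` is injective), and its image is an étale `R`-subalgebra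
`T = R[θ, u] ⊆ L`, `u = p′(θ)⁻¹`.

* `exists_etaleChart_of_root` — **the étale chart of a simple root in the field**, with: `θ ∈ T`,
  `u ∈ T`, `T = R[θ, u]`, `u · p′(θ) = 1`; `u` lies in every subfield containing `R` and `θ`;
  and for every valuation ring `V ⊇ R` of `L` with `θ ∈ V` and `|p′(θ)|_V = 1` one has `T ⊆ V`
  and `|u|_V = 1` — PROVED (the proof of `exists_henselChart` verbatim for a general `p`).

No monicity or minimality of `p` is needed. All statements are [folklore]; no definitions, no
named facts.

## Sources

* M. Temkin, arXiv:0804.1554v3, proof of Thm. 3.3.1, Steps 3–4 (p. 45) (the use); The Stacks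
  Project, Tag 00UE-type standard étale algebras, through the tree (`EtalePair`).
-/

noncomputable section

open Polynomial

open scoped Polynomial.Bivariate

namespace Literature.AlgebraicGeometry.Resolution

universe u

section Chart

variable {R L : Type u} [CommRing R] [IsDomain R] [IsIntegrallyClosed R] [Field L] [Algebra R L]

/-- **The étale chart of a simple root, realized in the field.** Let `R` be an integrally
closed domain inside a field `L` (`hR`), `p ∈ R[X]`, and `θ ∈ L` with `p(θ) = 0`, `p′(θ) ≠ 0`.
Then there are an `R`-subalgebra `T ⊆ L`, ÉTALE over `R`, and `u ∈ T` with: `θ ∈ T`;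
`T = R[θ, u]`; `u · p′(θ) = 1`; `u` lies in every subfield of `L` containing `R` and `θ`; and for
every valuation ring `V ⊇ R` of `L` with `θ ∈ V` and `|p′(θ)|_V = 1` one has `T ⊆ V` and
`|u|_V = 1`. (`T` is `(R[X]/p)[1/p′]` cut down to the sheet of `θ` and embedded by `X ↦ θ`.)
[folklore] -/
theorem exists_etaleChart_of_root (hR : Function.Injective (algebraMap R L)) (p : R[X]) (θ : L)
    (hpθ : aeval θ p = 0) (hpθ' : aeval θ (derivative p) ≠ 0) :
    ∃ (T : Subalgebra R L) (u : L), Algebra.Etale R T ∧ θ ∈ T ∧ u ∈ T ∧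
      T = Algebra.adjoin R ({θ, u} : Set L) ∧ u * aeval θ (derivative p) = 1 ∧
      (∀ F : Subfield L, (∀ r : R, algebraMap R L r ∈ F) → θ ∈ F → u ∈ F) ∧
      ∀ V : ValuationSubring L, (∀ r : R, algebraMap R L r ∈ V) → θ ∈ V →
        V.valuation (aeval θ (derivative p)) = 1 →
        T.toSubring ≤ V.toSubring ∧ V.valuation u = 1 := by
  classical
  -- the étale pair and its map to `L`
  let Pp : EtalePair R := EtalePair.ofDerivative p
  have hmap : Pp.HasMap θ := ⟨hpθ, isUnit_iff_ne_zero.mpr hpθ'⟩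
  let ψ : Pp.Ring →ₐ[R] L := Pp.lift θ hmap
  letI : Algebra Pp.Ring L := ψ.toRingHom.toAlgebra
  haveI : IsScalarTower R Pp.Ring L :=
    IsScalarTower.of_algebraMap_eq fun r => (ψ.commutes r).symm
  have hψ : ∀ s, algebraMap Pp.Ring L s = ψ s := fun _ => rfl
  -- `u = p′(θ)⁻¹ = ψ(Y)`
  set u : L := (aeval θ (derivative p))⁻¹ with hu
  have hψX : ψ Pp.X = θ := Pp.lift_X θ hmap
  have hunit : (↑(hmap.2.unit⁻¹) : L) = u := by
    rw [Units.val_inv_eq_inv_val, IsUnit.unit_spec]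
    rfl
  have hψY : ψ Pp.invG = u := by
    rw [EtalePair.lift_invG, hunit]
  -- sheet selection and the injective localization
  obtain ⟨s₀, h1, hkill⟩ :=
    exists_eq_one_and_mul_eq_zero_of_etale (R := R) (S := Pp.Ring) (L := L) hR
  let Sₛ := Localization.Away s₀
  have hs₀ : IsUnit (ψ s₀) := by rw [← hψ, h1]; exact isUnit_one
  let Λ : Sₛ →ₐ[R] L := IsLocalization.Away.liftAlgHom s₀ hs₀
  have hΛinj : Function.Injective Λ := injective_awayLift_of_etale h1 hkill Sₛ
  have hΛalg : ∀ s : Pp.Ring, Λ (algebraMap Pp.Ring Sₛ s) = ψ s := fun s =>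
    IsLocalization.Away.lift_eq s₀ hs₀ s
  -- the chart
  let T : Subalgebra R L := Λ.range
  haveI : Algebra.Etale R Sₛ := inferInstance
  have hT : Algebra.Etale R T := Algebra.Etale.of_equiv (AlgEquiv.ofInjective Λ hΛinj)
  have hθT : θ ∈ T := (AlgHom.mem_range Λ).mpr ⟨algebraMap Pp.Ring Sₛ Pp.X, by rw [hΛalg, hψX]⟩
  have huT : u ∈ T := (AlgHom.mem_range Λ).mpr ⟨algebraMap Pp.Ring Sₛ Pp.invG, by rw [hΛalg, hψY]⟩
  have hTeq : T = Algebra.adjoin R ({θ, u} : Set L) := by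
    apply le_antisymm
    · intro x hx
      obtain ⟨w, rfl⟩ := (AlgHom.mem_range Λ).mp hx
      obtain ⟨⟨s, y⟩, rfl⟩ := IsLocalization.mk'_surjective (Submonoid.powers s₀) w
      obtain ⟨n, hn⟩ := (Submonoid.mem_powers_iff (y : Pp.Ring) s₀).mp y.2
      have hw : Λ (IsLocalization.mk' Sₛ s y) = ψ s := by
        have h2 : Λ (IsLocalization.mk' Sₛ s y) *
            Λ (algebraMap Pp.Ring Sₛ (y : Pp.Ring)) = Λ (algebraMap Pp.Ring Sₛ s) := by
          rw [← map_mul, IsLocalization.mk'_spec Sₛ s y]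
        rw [hΛalg, hΛalg, ← hn, map_pow, ← hψ s₀, h1, one_pow, mul_one] at h2
        exact h2
      show Λ (IsLocalization.mk' Sₛ s y) ∈ Algebra.adjoin R ({θ, u} : Set L)
      rw [hw]
      obtain ⟨q, rfl⟩ := Pp.proj_surjective s
      change Pp.lift θ hmap (Pp.proj q) ∈ _
      rw [EtalePair.lift_proj, hunit]
      exact aevalAeval_mem_adjoin θ u q
    · refine Algebra.adjoin_le ?_
      rintro x (rfl | rfl)
      · exact hθT
      · exact huT
  refine ⟨T, u, hT, hθT, huT, hTeq, by rw [hu]; exact inv_mul_cancel₀ hpθ',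
    fun F hRF hθF => ?_, fun V hRV hθV hvθ => ?_⟩
  · -- `u ∈ F`
    exact F.inv_mem (aeval_mem_subfield_of_mem F hRF hθF _)
  · -- the valuation ring of the point
    have hvu : V.valuation u = 1 := by rw [hu, map_inv₀, hvθ, inv_one]
    refine ⟨?_, hvu⟩
    have huV : u ∈ V := (V.valuation_le_one_iff _).mp hvu.le
    let V' : Subalgebra R L :=
      { V.toSubring with
        algebraMap_mem' := fun r => hRV r }
    have hle : Algebra.adjoin R ({θ, u} : Set L) ≤ V' := by
      refine Algebra.adjoin_le ?_
      rintro x (rfl | rfl)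
      · exact hθV
      · exact huV
    intro x hx
    have hx' : x ∈ Algebra.adjoin R ({θ, u} : Set L) := by rw [← hTeq]; exact hx
    exact hle hx'

omit [IsDomain R] [IsIntegrallyClosed R] in
/-- **Elements of the chart.** Every element of the chart `T = R[θ, u]` of
`exists_etaleChart_of_root` is a two-variable polynomial expression `q(θ, u)` over `R`; in
particular it lies in every `R`-subalgebra of `L` containing `θ` and `u`. [folklore] -/
theorem adjoin_pair_le_of_mem {S : Subalgebra R L} {θ u : L} (hθ : θ ∈ S) (hu : u ∈ S) :
    Algebra.adjoin R ({θ, u} : Set L) ≤ S := by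
  refine Algebra.adjoin_le ?_
  rintro x (rfl | rfl)
  · exact hθ
  · exact hu

end Chart

end Literature.AlgebraicGeometry.Resolution

end
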